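import Summits.ABC.ABC.Theses.PadicPrimesKummerThird
import Literature.Barriers.ABC.BakerMethodBoundsKummerArchProofs
import Literature.NumberTheory.Transcendental.PhilipponZeroEstimateMultidegree
import HarnessLib

/-! Post-birth import form of the registered BC3 birth skeleton (planner g6 registered
`m3hb/post/Y07Odd_birth.lean`, skeleton sha a213be5b…/266d2e09…, 2026-08-26T14:19Z/14:27Z; this copy is
rebuilt by planner g7 from the cell's pre-birth record `HOME/plan-m3/bc/Y07Odd_birth.lean` with the
statement block replaced by the route import — stub names and signatures unchanged). -/

/-! # Birth skeleton (BC3) for crux `Y07Odd` — line `gen3-zero-estimate-end` (planner plan-m3 g0, 2026-08-26)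

The crux is the Yu-2007-quality `p`-adic text for rational PRIMES at odd `p`.  The line: a Gen-3 engine
(`c^m`, `p/(log p)²`, one log) for rational `p`-adic UNITS (`GenThreeEngineOdd`, the natural theorem; the
crux is its prime instance) built on the cell's landed descent architecture, whose one EXTERNAL input is the
zero estimate with multiplicity and unequal multidegrees (`Nesterenko2003_prop51`, tree named fact since p447121,
both tree parents proved), replacing the Vandermonde endgame that forces `m^m` in every landed engine
(W80/CW77: `C(m) ∋ m^{2m}`, p2 memo-04).  Three registered stubs: `stub_zeroEstimate` (shared with `Y07Two`),
`stub_engineOdd : Nesterenko2003_prop51 → GenThreeEngineOdd` (XL, load-bearing), `stub_transferOdd` (M). -/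

namespace Summit.ABC.ABC.Cruxes.Y07Odd.Birth

open Summit.ABC.ABC.Theses.PadicPrimesKummerThird
open Literature.NumberTheory.Transcendental Literature.NumberTheory.Transcendental.GaGm

/- v2 (2026-08-26 13:3xZ): the shared zero-estimate stub is the tree's NAMED FACT
`Literature.NumberTheory.Transcendental.Nesterenko2003_prop51` (Nesterenko 2003, Prop. 5.1 =
Waldschmidt 2000 Thm 8.1 = Philippon 1986 Thm 2.1 on `𝔾ₐ × 𝔾ₘⁿ ⊂ (ℙ¹)ⁿ⁺¹` with multiplicity `T`
along `W` and unequal Laurent multidegrees; lit g5, p447121, unproved named fact, cite-tagged) BY NAME.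
The v1 local polynomial-degree variant `PhilipponMultidegree` (record copy
`bc/Y07Odd_birth.v1-1301Z.lean`; cross-read HOME/lit/SOURCES.md §18.3: v1 ⇒ named fact on `D ≥ 1, W ≠ 0`,
the converse up to `2ⁿ` and the translate clause — immaterial for Nesterenko §5.2) is RETIRED so that no
near-duplicate of a Literature decl is introduced.  Both tree parents of the fact are PROVED:
`Philippon1986_GaGm_holds` (multiplicity, `ℙ¹ × ℙᵐ`, lossy constant) and `Philippon1986_GaGm_P1n_holds`
(`(ℙ¹)ⁿ⁺¹`, `T = 0`, exact `(n+1)!`); the discharge `Nesterenko2003_prop51_holds` is their MERGE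
(`T > 0` × unequal `D_j` × general-rank minors sum). -/

/-- **Gen-3 unit-form engine text, odd `p`** (Yu 2007 quality over `K = ℚ`; the M2 engine
hypotheses of `Summit.ABC.StewartYu.YuNinetyW80.residueClass_of_w80Engine` — rational `p`-adic units,
multiplicatively independent, 2-Kummer condition (free for primes), heights `h(αⱼ) ≤ Vⱼ ≤ Vmax` with the
`p`-INDEPENDENT floor `log 2 ≤ Vⱼ`, `log max(3,|bⱼ|) ≤ W` — with the Gen-3 conclusion: constant
`C(m) ≤ c₁^m` (no `m^m`), `p/(log p)²` in `ord_p` units, ONE logarithm):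
`ord_p(∏ αⱼ^{bⱼ} − 1) · log p ≤ C(m) · (p/log p) · ∏ Vⱼ · (W + log p + log(2Vmax))`.
(Yu's `log M`, `M ≍ B·p^{n+1}·∏_{k≠k₀} h'ₖ`, is `≤ (m+1)(W + log p + log 2Vmax)`, the `m+1` absorbed in
`c₁^m`.)  [cite: Yu2007, Main Thm (K = ℚ, e = f = 1) via EvertseGyory2015 Thm 3.2.7; shape only] -/
def GenThreeEngineOdd : Prop :=
  ∃ (C : ℕ → ℝ) (c₁ : ℝ), 1 ≤ c₁ ∧ (∀ m, 0 ≤ C m ∧ C m ≤ c₁ ^ m) ∧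
    ∀ (p : ℕ), p.Prime → p ≠ 2 → ∀ (m : ℕ) (α : Fin m → ℚ) (b : Fin m → ℤ) (V : Fin m → ℝ)
      (Vmax W : ℝ),
      (∀ j, α j ≠ 0 ∧ padicValRat p (α j) = 0) →
      (∀ μ : Fin m → ℤ, ∏ j, α j ^ μ j = 1 → μ = 0) →
      (∀ T : Finset (Fin m), T.Nonempty → ¬ IsSquare (∏ j ∈ T, α j) ∧ ¬ IsSquare (-∏ j ∈ T, α j)) →
      (∀ j, Height.logHeight₁ (α j) ≤ V j) → (∀ j, Real.log 2 ≤ V j) → (∀ j, V j ≤ Vmax) →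
      b ≠ 0 → (∀ j, Real.log (max 3 (|b j| : ℝ)) ≤ W) →
      (padicValRat p (∏ j, α j ^ b j - 1) : ℝ) * Real.log p ≤
        C m * ((p : ℝ) / Real.log p) * (∏ j, V j) * (W + Real.log p + Real.log (2 * Vmax))

/-- STUB (shared with the `Y07Two` skeleton; L–XL, parents proved): the zero estimate with multiplicity
and unequal multidegrees, `Nesterenko2003_prop51` (tree named fact; discharge = merge of the proved
`Philippon1986_GaGm_holds` and `Philippon1986_GaGm_P1n_holds`). -/
theorem stub_zeroEstimate : Nesterenko2003_prop51 := by
  sorry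

/-- STUB (load-bearing, XL): the Gen-3 `p`-adic engine from the zero estimate — the cell's landed
one-variable descent architecture (PadicTwist*/PadicCW77* at odd `p`, PadicTwo* at `p = 2`) with the three
Matveev/Nesterenko-2003 deltas (p2 memo-06): unknowns indexed by the height-weighted box (the lattice part
is trivial for independent units), `n` directional Feldman Δ-weights, and the §5 zero-estimate END
(`Nesterenko2003_prop51` → obstruction subgroup `G* = V × T_Φ` → Nesterenko Lemmas 5.2–5.4 → Matveev's
sublattice, Prop. 2.6 by `Dioph.minkowski_second_core`) replacing the Vandermonde endgame; `p`-adic radii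
per the K-M3.1 parameter ledger (gain `log p / 2` per zero, Yu's class count `≤ p − 1`). -/
theorem stub_engineOdd : Nesterenko2003_prop51 → GenThreeEngineOdd := by
  sorry

/-- STUB (transfer, M; pattern = the landed `Summit.ABC.StewartYu.YuNinetyW80.residueClass_of_w80Engine`):
engine ⇒ crux.  `S ≃ Fin m` (`m = #S ≥ 1`), `αⱼ = qⱼ` (a `p`-adic unit since `p ∉ S`; distinct primes are
multiplicatively independent and no signed sub-product is a square — unique factorisation, lemmas already
in the M2 transfer file), `bⱼ = e qⱼ ≠ 0`-vector (else the product is `1`), `Vⱼ = log qⱼ ≥ log 2`,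
`Vmax = log A` (`A = max 4 (sup S)`), `W = log B` (`B ≥ 3`); then
`W + log p + log(2 log A) ≤ 3·(log p + log B + log log A)` (`log log A ≥ log log 4 > 0.3`, `log B ≥ 1`),
so `c₆ = 3c₁ + 1` (strict `<`). -/
def TransferOdd : Prop := GenThreeEngineOdd → Y07Odd

/-- STUB (transfer, M): `TransferOdd` = engine text ⇒ crux (see the def above). -/
theorem stub_transferOdd : TransferOdd := by
  sorry

/-- BC3 composition (hypothesis form): the crux BY NAME from exactly the three stub STATEMENTS;
kernel-checked, no sorry of its own. -/
theorem Y07Odd_of : Nesterenko2003_prop51 → (Nesterenko2003_prop51 → GenThreeEngineOdd) →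
    TransferOdd → Y07Odd :=
  fun z e t => t (e z)

/-- BC3 composition (closed form, A12 shape): the crux BY NAME with NO hypotheses, from exactly the
registered stubs. -/
theorem Y07Odd_closed : Y07Odd :=
  Y07Odd_of stub_zeroEstimate stub_engineOdd stub_transferOdd

end Summit.ABC.ABC.Cruxes.Y07Odd.Birth
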